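import Mathlib.Analysis.Calculus.Gradient.Basic
import Mathlib.Analysis.InnerProductSpace.PiL2
import Mathlib.Analysis.InnerProductSpace.Calculus
import Mathlib.Analysis.Calculus.ContDiff.Basic
import Mathlib.Analysis.Calculus.ContDiff.Operations
import Mathlib.Analysis.Calculus.FDeriv.Symmetric
import Mathlib.LinearAlgebra.Matrix.Adjugate
import Mathlib.MeasureTheory.Integral.Bochner.Basic
import Mathlib.MeasureTheory.Integral.Bochner.Set
import Mathlib.MeasureTheory.Measure.Haar.InnerProductSpace
import Literature.Analysis.Calculus.SubmersionNullPreimage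
import Literature.AlgebraicTopology.SingularHomology.EulerCharacteristicTriple
import HarnessLib

/-!
# Level-set Gauss–Bonnet in coarea form: `∫_{q⁻¹(B)} K_Σ |∇q| dx = 2π ∫_B χ(Σ_s) ds`

Topic `Geometry/Riemannian` (next to `KConvexLevelSet.lean`, `LevelSetMeanCurvature.lean`); cite
item `wi-23960` of route `NavierStokesRegularity/IsobarTomography` ("level-set Gauss–Bonnet with
coarea: Euler characteristic of regular level surfaces in `ℝ³` from the Hessian"; the identity
(GB), the tube floor / blob charge and the definition request `isobarEulerBudget` of that route
are read through the named fact below; the algebraic splitting of the integrand is the route's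
own item `GaussKroneckerSplit`).

## Sources (read; page files under `lit read`)

* D. Stern, *Scalar curvature and harmonic maps to `S¹`*, J. Differential Geom. 122 (2022)
  = arXiv:1908.09754, **§2, proof of Thm. 1.1**: for `B` a closed set of regular values,
  "By the coarea formula and the Gauss–Bonnet theorem, we see finally that
  `∫_{u⁻¹(B)} (|du|/2)(|du|⁻²|Hess u|² + (R_M − R_Σ)) = ½∫_B∫_{Σ_θ}(|du|⁻²|Hess u|² + R_M) − ∫_B 2πχ(Σ_θ)`",
  i.e. `∫_{u⁻¹(B)} |du| K_{Σ} = 2π ∫_B χ(Σ_θ) dθ` (`R_Σ = 2K_Σ` on a surface); `χ(Σ_θ)` "denotes the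
  sum of [the] Euler characteristics" of the components. [Stern2022]
* H. Bray, D. Kazaras, M. Khuri, D. Stern, *Harmonic functions and the mass of 3-dimensional
  asymptotically flat Riemannian manifolds*, J. Geom. Anal. 32 (2022) = arXiv:1911.06754, Lemma 4.1
  and proof of Prop. 4.2 (arXiv §3): the same step, "applying the coarea formula to
  `u : u⁻¹(𝓑) → 𝓑`" and "where in the second step we have applied the Gauss–Bonnet theorem to
  `Σ_t`". [BrayEtAl2022]
* R. Goldman, *Curvature formulas for implicit curves and surfaces*, Comput. Aided Geom. Design 22
  (2005) 632–658, **§4 eq. (4.1) = Thm. 4.1**: the Gaussian curvature of the implicit surface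
  `F = 0` (at a regular point, `F ∈ C²`) is `K_G = ∇F · H*(F) · ∇Fᵀ / |∇F|⁴`, `H*(F)` the adjoint
  (= adjugate, matrix of cofactors) of the Hessian `H(F)`; p. 642: "The normalizing factor `|∇F|⁴`
  … insures that `cF = 0` has the same curvature as `F = 0`". [Goldman2005]
* M. Abate, F. Tovena, *Curves and Surfaces* (Springer 2012): Prop. 3.1.25 (each component of a
  regular level set `f⁻¹(a)`, `f ∈ C^∞`, is a regular surface), Thm. 4.7.15 / Remark 6.3.11 (every
  compact surface in `ℝ³` is orientable), **Cor. 6.3.10** (global Gauss–Bonnet: `∫_S K dν = 2πχ(S)`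
  for a compact surface `S ⊂ ℝ³`). [AbateTovena2012]
* L. C. Evans, R. F. Gariepy, *Measure theory and fine properties of functions*, revised ed.
  (2015), **Thm. 3.11** (integration over level sets: `∫ g Jf dx = ∫ (∫_{f⁻¹{y}} g dℋ^{n−1}) dy`,
  `Jf = |Df|`, Thm. 3.13). [EvansGariepy2015]
* A. Hatcher, *Algebraic Topology* (2002), Thm. 2.44: the Euler characteristic of a finite complex
  is `Σ (−1)ⁿ rank Hₙ` — the tree's `Literature.AlgebraicTopology.SingularHomology.relEuler`, used
  here for `χ(Σ_s)`. [HatcherAT2002]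

## What is here

* `hessianMatrix q x` — the Hessian of `q : ℝⁿ → ℝ` at `x` as a matrix in the standard basis,
  `(D²q(x)[eᵢ, eⱼ])ᵢⱼ` (Mathlib's `iteratedFDeriv ℝ 2 q x ![eᵢ, eⱼ]`); symmetric for `q ∈ C²`
  (`hessianMatrix_isSymm`), `hessianMatrix (c q) = c • hessianMatrix q`, and
  `hessianMatrix ‖·‖² = 2 I`.
* `levelSetGaussCurvature q x` — **Goldman's adjoint-Hessian formula (4.1) taken as the
  DEFINITION** of the Gauss curvature at `x` of the level surface `{q = q x}` of `q : ℝ³ → ℝ`: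
  `K = ∇qᵀ adj(∇²q) ∇q / |∇q|⁴` (Mathlib has no Gauss curvature of a surface; Goldman's Thm. 4.1 is
  the statement that this IS the Gauss curvature of the regular implicit surface). Junk value `0`
  at critical points. PROVED sanity checks: `levelSetGaussCurvature_norm_sq` — for `q = ‖·‖²`
  (level sets: round spheres of radius `‖x‖`) the value is `1/‖x‖²`; scale invariance
  `levelSetGaussCurvature_const_mul` (Goldman p. 642); `levelSetGaussCurvature_mul_norm`
  (`K |∇q| = ∇qᵀ adj(∇²q) ∇q / |∇q|³`, the integrand of the isobar Euler budget).
* `levelSetEulerChar q s = χ(q⁻¹{s})` — the (homological) Euler characteristic of the level set,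
  an abbreviation for the tree's `relEuler ℤ ℤ ↥(q⁻¹{s}) ∅`.
* NAMED FACT `levelSet_gaussBonnet_coarea` — **level-set Gauss–Bonnet in coarea form** in flat
  `ℝ³` (Stern's step with `R_M = 0`, `R_Σ = 2K_Σ`, and `K_Σ` written by Goldman's formula): for
  `q : ℝ³ → ℝ` smooth and `B ⊂ ℝ` compact with `q⁻¹(B)` compact and free of critical points,
  `∫_{q⁻¹(B)} K |∇q| dx = 2π ∫_B χ(Σ_s) ds`. Not proved: Mathlib has neither the coarea formula nor
  the Gauss–Bonnet theorem.
* PROVED around it: `volume_preimage_singleton_eq_zero_of_gradient_ne_zero` (regular level sets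
  are Lebesgue-null, from the tree's `measure_inter_preimage_null_of_submersion`),
  `preimage_Ioo_ae_eq_preimage_Icc`, and the slab corollaries of the fact in the route's
  normalisation, `levelSet_gaussBonnet_coarea.slab` / `.slab_Ioo`:
  `2 ∫_{a<q<b} ∇qᵀadj(∇²q)∇q/|∇q|³ dx = 4π ∫_{[a,b]} χ(Σ_s) ds`.

## Deliberately NOT here

* Constancy of `s ↦ χ(Σ_s)` on a critical-point-free compact slab `q⁻¹[a, b]` (all these level
  sets are diffeomorphic: Hirsch, *Differential Topology*, Ch. 6 Thm. 2.2 / Milnor, *Morse theory*,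
  Thm. 3.1 — the tree PROVES the open regular interval theorem,
  `Literature.Geometry.Manifold.exists_diffeomorph_prod_real_of_surjective_mfderiv`; the transfer
  to `relEuler` of level sets of a function on `ℝ³` is left to a later proof and is NOT minted as a
  fact here), which turns the right-hand side into `4π (b − a) χ(Σ_a)`.
* The Morse-theoretic extension across non-degenerate critical values (jumps `2(−1)^{ind}` of
  `χ(Σ_s)`), the mean curvature formula (Goldman (4.2); cf. `LevelSetMeanCurvature.lean`), and the
  identification of `levelSetGaussCurvature` with the Gauss curvature of the tree's abstract
  hypersurfaces (`Literature.Geometry.Lorentzian.Hypersurface`).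

## Design notes

* Regularity: the fact is stated for smooth `q` (`ContDiff ℝ ∞`), as in Stern / Bray–Kazaras–
  Khuri–Stern and Abate–Tovena (regular surfaces are `C^∞`); the consumers (pressure slices of
  classical Navier–Stokes solutions) are smooth.
* `B` is any compact set of values with `q⁻¹(B)` compact and regular (Stern's "closed subset of
  regular values"); on `B` the map `s ↦ χ(Σ_s)` is locally constant (regular interval theorem
  near the compact `q⁻¹(B)`), so the right-hand side is a genuine finite integral, and the
  left integrand is continuous on the compact `q⁻¹(B)`.
* The Hessian enters through a MATRIX and Mathlib's `Matrix.adjugate`, matching the route item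
  `GaussKroneckerSplit` (`2 nᵀadj(M)n = (tr M − nᵀMn)² − |M|²_F + 2|Mn|² − (nᵀMn)²` for symmetric
  `M`; symmetry is `hessianMatrix_isSymm`).
-/

noncomputable section

open MeasureTheory WithLp Matrix Set
open scoped RealInnerProductSpace Real ContDiff

namespace Literature.Geometry.Riemannian

/-! ### The Hessian matrix in the standard basis -/

section Hessian

variable {n : ℕ}

/-- The **Hessian matrix** of `q : ℝⁿ → ℝ` at `x` in the standard orthonormal basis
`eᵢ = EuclideanSpace.single i 1`: `(∇²q(x))ᵢⱼ = D²q(x)[eᵢ, eⱼ] = ∂ᵢ∂ⱼ q(x)` (Goldman 2005, §4: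
`H(F) = (F_{x_i x_j})`). Junk value where `q` is not twice differentiable (inherited from
`iteratedFDeriv`). [cite: Goldman2005, §4 (the hessian H(F))] -/
def hessianMatrix (q : EuclideanSpace ℝ (Fin n) → ℝ) (x : EuclideanSpace ℝ (Fin n)) :
    Matrix (Fin n) (Fin n) ℝ :=
  Matrix.of fun i j => iteratedFDeriv ℝ 2 q x ![EuclideanSpace.single i 1, EuclideanSpace.single j 1]

/-- Entries of the Hessian matrix. [folklore] -/
theorem hessianMatrix_apply (q : EuclideanSpace ℝ (Fin n) → ℝ) (x : EuclideanSpace ℝ (Fin n))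
    (i j : Fin n) :
    hessianMatrix q x i j =
      iteratedFDeriv ℝ 2 q x ![EuclideanSpace.single i 1, EuclideanSpace.single j 1] := rfl

/-- Entries of the Hessian matrix through `fderiv (fderiv q)` (Mathlib's
`iteratedFDeriv_two_apply`). [folklore] -/
theorem hessianMatrix_apply_eq_fderiv_fderiv (q : EuclideanSpace ℝ (Fin n) → ℝ)
    (x : EuclideanSpace ℝ (Fin n)) (i j : Fin n) :
    hessianMatrix q x i j =
      fderiv ℝ (fderiv ℝ q) x (EuclideanSpace.single i 1) (EuclideanSpace.single j 1) := by
  rw [hessianMatrix_apply, iteratedFDeriv_two_apply]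
  rfl

/-- **The Hessian matrix of a `C²` function is symmetric** (Schwarz; Mathlib's
`ContDiffAt.isSymmSndFDerivAt`). [folklore] -/
theorem hessianMatrix_isSymm {q : EuclideanSpace ℝ (Fin n) → ℝ} {x : EuclideanSpace ℝ (Fin n)}
    (hq : ContDiffAt ℝ 2 q x) : (hessianMatrix q x).IsSymm := by
  have hs : IsSymmSndFDerivAt ℝ q x := hq.isSymmSndFDerivAt (by simp)
  ext i j
  rw [Matrix.transpose_apply, hessianMatrix_apply_eq_fderiv_fderiv,
    hessianMatrix_apply_eq_fderiv_fderiv]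
  exact hs.eq _ _

/-- The Hessian matrix is homogeneous: `∇²(c q) = c ∇²q` (for `q` of class `C²` at `x`). [folklore] -/
theorem hessianMatrix_const_mul {q : EuclideanSpace ℝ (Fin n) → ℝ} {x : EuclideanSpace ℝ (Fin n)}
    (hq : ContDiffAt ℝ 2 q x) (c : ℝ) :
    hessianMatrix (fun y => c * q y) x = c • hessianMatrix q x := by
  ext i j
  have : (fun y => c * q y) = c • q := by ext y; simp
  rw [Matrix.smul_apply, hessianMatrix_apply, hessianMatrix_apply, this,
    iteratedFDeriv_const_smul_apply hq]
  rfl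

/-- The Hessian matrix of `‖·‖²` is `2 I`. [folklore] -/
theorem hessianMatrix_norm_sq (x : EuclideanSpace ℝ (Fin n)) :
    hessianMatrix (fun y : EuclideanSpace ℝ (Fin n) => ‖y‖ ^ 2) x =
      (2 : ℝ) • (1 : Matrix (Fin n) (Fin n) ℝ) := by
  ext i j
  rw [hessianMatrix_apply_eq_fderiv_fderiv]
  have h1 : fderiv ℝ (fun y : EuclideanSpace ℝ (Fin n) => ‖y‖ ^ 2) =
      ⇑((2 : ℝ) • (innerSL ℝ : EuclideanSpace ℝ (Fin n) →L[ℝ] EuclideanSpace ℝ (Fin n) →L[ℝ] ℝ)) := by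
    funext y
    rw [(hasStrictFDerivAt_norm_sq y).hasFDerivAt.fderiv]
    ext v
    simp [two_smul]
  rw [h1, ContinuousLinearMap.fderiv]
  change 2 * ⟪EuclideanSpace.single i (1 : ℝ), EuclideanSpace.single j (1 : ℝ)⟫ = _
  simp [EuclideanSpace.inner_single_left, Matrix.one_apply]

end Hessian

/-! ### Gradients: two elementary lemmas -/

section Gradient

variable {E : Type*} [NormedAddCommGroup E] [InnerProductSpace ℝ E] [CompleteSpace E]

/-- The gradient is homogeneous, `∇(c q) = c ∇q`, without differentiability hypothesis (real
scalars; Mathlib's `fderiv_const_smul_field`). [folklore] -/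
theorem gradient_const_smul_field (q : E → ℝ) (c : ℝ) (x : E) :
    gradient (c • q) x = c • gradient q x := by
  simp [gradient, fderiv_const_smul_field]

/-- `∇‖·‖²(x) = 2x`. [folklore] -/
theorem gradient_norm_sq (x : E) : gradient (fun y : E => ‖y‖ ^ 2) x = (2 : ℝ) • x := by
  refine HasGradientAt.gradient ?_
  rw [hasGradientAt_iff_hasFDerivAt]
  refine (hasStrictFDerivAt_norm_sq x).hasFDerivAt.congr_fderiv ?_
  ext v
  simp [InnerProductSpace.toDual_apply_apply, two_smul]

/-- A non-zero gradient means a surjective differential `dq(x) : E → ℝ`. [folklore] -/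
theorem range_fderiv_eq_top_of_gradient_ne_zero {q : E → ℝ} {x : E} (hx : gradient q x ≠ 0) :
    LinearMap.range (fderiv ℝ q x : E →ₗ[ℝ] ℝ) = ⊤ := by
  have hv : fderiv ℝ q x (gradient q x) ≠ 0 := by
    rw [← inner_gradient_left (𝕜 := ℝ)]
    exact inner_self_ne_zero.2 hx
  refine LinearMap.range_eq_top.2 fun t => ⟨(t / fderiv ℝ q x (gradient q x)) • gradient q x, ?_⟩
  rw [ContinuousLinearMap.coe_coe, map_smul, smul_eq_mul, div_mul_cancel₀ t hv]

/-- The gradient of a `C¹` function is continuous. [folklore] -/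
theorem continuous_gradient {q : E → ℝ} (hq : ContDiff ℝ 1 q) : Continuous (gradient q) :=
  (InnerProductSpace.toDual ℝ E).symm.continuous.comp (hq.continuous_fderiv one_ne_zero)

variable [FiniteDimensional ℝ E] [MeasurableSpace E] [BorelSpace E]

/-- **Regular level sets are Lebesgue-null**: if `q ∈ C¹` and `∇q ≠ 0` on `q⁻¹{s}`, then
`q⁻¹{s}` has measure zero (the level set lies in the open set of regular points, on which `q` is
a submersion, and submersions pull the null set `{s}` back to a null set — the tree's
`Literature.Analysis.Calculus.measure_inter_preimage_null_of_submersion`). [folklore] -/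
theorem volume_preimage_singleton_eq_zero_of_gradient_ne_zero {q : E → ℝ} (hq : ContDiff ℝ 1 q)
    {s : ℝ} (hreg : ∀ x ∈ q ⁻¹' {s}, gradient q x ≠ 0) : volume (q ⁻¹' {s}) = 0 := by
  set U : Set E := {x | gradient q x ≠ 0} with hU
  have hUo : IsOpen U := isOpen_ne_fun (continuous_gradient hq) continuous_const
  have hsub : q ⁻¹' {s} = U ∩ q ⁻¹' {s} := by
    ext x
    simp only [mem_inter_iff, mem_setOf_eq, U]
    exact ⟨fun h => ⟨hreg x h, h⟩, fun h => h.2⟩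
  rw [hsub]
  exact Literature.Analysis.Calculus.measure_inter_preimage_null_of_submersion volume volume hUo
    hq.contDiffOn (fun x hx => range_fderiv_eq_top_of_gradient_ne_zero hx) (by simp)

/-- On a regular slab the open and the closed slab agree almost everywhere:
`q⁻¹(a, b) = q⁻¹[a, b]` a.e., the difference lying in the null level sets `q⁻¹{a} ∪ q⁻¹{b}`.
[folklore] -/
theorem preimage_Ioo_ae_eq_preimage_Icc {q : E → ℝ} (hq : ContDiff ℝ 1 q) {a b : ℝ}
    (hreg : ∀ x ∈ q ⁻¹' Icc a b, gradient q x ≠ 0) :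
    (q ⁻¹' Ioo a b : Set E) =ᵐ[volume] q ⁻¹' Icc a b := by
  refine ae_eq_set.2 ⟨?_, ?_⟩
  · rw [Set.sdiff_eq_empty.2 (preimage_mono Ioo_subset_Icc_self), measure_empty]
  · rcases le_or_gt a b with hab | hab
    · have ha : volume (q ⁻¹' {a}) = 0 :=
        volume_preimage_singleton_eq_zero_of_gradient_ne_zero hq fun x hx =>
          hreg x (by simp only [mem_preimage, mem_singleton_iff] at hx; simp [hx, hab])
      have hb : volume (q ⁻¹' {b}) = 0 :=
        volume_preimage_singleton_eq_zero_of_gradient_ne_zero hq fun x hx =>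
          hreg x (by simp only [mem_preimage, mem_singleton_iff] at hx; simp [hx, hab])
      refine measure_mono_null (fun x hx => ?_) (measure_union_null ha hb)
      simp only [mem_sdiff, mem_preimage, mem_Icc, mem_Ioo, not_and, not_lt] at hx
      simp only [mem_union, mem_preimage, mem_singleton_iff]
      rcases hx.1.1.eq_or_lt with h | h
      · exact Or.inl h.symm
      · exact Or.inr (le_antisymm hx.1.2 (hx.2 h))
    · rw [Icc_eq_empty (not_le.2 hab), preimage_empty, empty_sdiff, measure_empty]

end Gradient

/-! ### Goldman's formula: the Gauss curvature of a level surface in `ℝ³` -/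

section GaussCurvature

/-- Local notation for physical space `ℝ³`. -/
local notation "ℝ³" => EuclideanSpace ℝ (Fin 3)

/-- **The Gauss curvature of the level surface of `q : ℝ³ → ℝ` through `x`, by Goldman's
adjoint-Hessian formula**: `K = ∇qᵀ adj(∇²q) ∇q / |∇q|⁴` (Goldman 2005, §4, eq. (4.1) = Thm. 4.1:
"`K_G = ∇F · H*(F) · ∇Fᵀ / |∇F|⁴`", `H*` the adjoint = adjugate of the Hessian, valid at every
regular point of the implicit surface `F = F(x)`; Spivak, vol. 3, p. 204). Mathlib has no Gauss
curvature of a surface, so the formula is the definition; junk value `0` at critical points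
(`‖∇q‖ = 0`). Even in `q ↦ −q` and invariant under `q ↦ c q`, `c ≠ 0`
(`levelSetGaussCurvature_const_mul`); equal to `1/‖x‖²` for `q = ‖·‖²`
(`levelSetGaussCurvature_norm_sq`). [cite: Goldman2005, §4 eq. (4.1) / Thm. 4.1] -/
def levelSetGaussCurvature (q : ℝ³ → ℝ) (x : ℝ³) : ℝ :=
  (ofLp (gradient q x) ⬝ᵥ ((hessianMatrix q x).adjugate *ᵥ ofLp (gradient q x))) /
    ‖gradient q x‖ ^ 4

/-- Unfolding Goldman's formula. [cite: Goldman2005, §4 eq. (4.1) / Thm. 4.1] -/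
theorem levelSetGaussCurvature_def (q : ℝ³ → ℝ) (x : ℝ³) :
    levelSetGaussCurvature q x =
      (ofLp (gradient q x) ⬝ᵥ ((hessianMatrix q x).adjugate *ᵥ ofLp (gradient q x))) /
        ‖gradient q x‖ ^ 4 := rfl

/-- At a critical point the (junk) value is `0`. [folklore] -/
theorem levelSetGaussCurvature_of_gradient_eq_zero {q : ℝ³ → ℝ} {x : ℝ³} (h : gradient q x = 0) :
    levelSetGaussCurvature q x = 0 := by
  simp [levelSetGaussCurvature, h]

/-- **The integrand of the isobar Euler budget**: `K |∇q| = ∇qᵀ adj(∇²q) ∇q / |∇q|³` (both sides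
vanish at critical points). [cite: Goldman2005, §4 eq. (4.1) / Thm. 4.1] -/
theorem levelSetGaussCurvature_mul_norm (q : ℝ³ → ℝ) (x : ℝ³) :
    levelSetGaussCurvature q x * ‖gradient q x‖ =
      (ofLp (gradient q x) ⬝ᵥ ((hessianMatrix q x).adjugate *ᵥ ofLp (gradient q x))) /
        ‖gradient q x‖ ^ 3 := by
  rcases eq_or_ne (gradient q x) 0 with h | h
  · simp [levelSetGaussCurvature, h]
  · have hn : ‖gradient q x‖ ≠ 0 := norm_ne_zero_iff.2 h
    rw [levelSetGaussCurvature]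
    field_simp

/-- **Scale invariance** (Goldman 2005, p. 642: "the normalizing factor `|∇F|⁴` … insures that
`cF = 0` has the same curvature as `F = 0`"): for `c ≠ 0` and `q` of class `C²` at `x`,
`K_{c q}(x) = K_q(x)` (`∇(cq) = c∇q`, `adj(c∇²q) = c² adj(∇²q)`). [cite: Goldman2005, §4, remark after (4.2) (p. 642)] -/
theorem levelSetGaussCurvature_const_mul {q : ℝ³ → ℝ} {x : ℝ³} (hq : ContDiffAt ℝ 2 q x) {c : ℝ}
    (hc : c ≠ 0) : levelSetGaussCurvature (fun y => c * q y) x = levelSetGaussCurvature q x := by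
  have hg : gradient (fun y => c * q y) x = c • gradient q x := by
    have : (fun y => c * q y) = c • q := by ext y; simp
    rw [this, gradient_const_smul_field]
  rw [levelSetGaussCurvature, levelSetGaussCurvature, hessianMatrix_const_mul hq, hg,
    Matrix.adjugate_smul, Fintype.card_fin]
  simp only [WithLp.ofLp_smul, Matrix.smul_mulVec, Matrix.mulVec_smul, dotProduct_smul,
    smul_dotProduct, norm_smul, smul_eq_mul, Real.norm_eq_abs, mul_pow]
  have h4 : |c| ^ 4 = c ^ 4 := by rw [pow_abs, abs_of_nonneg (by positivity)]
  rw [h4]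
  have hc4 : c ^ 4 ≠ 0 := pow_ne_zero 4 hc
  rw [show c * (c ^ (3 - 1) * (c * (ofLp (gradient q x) ⬝ᵥ
      (hessianMatrix q x).adjugate *ᵥ ofLp (gradient q x)))) =
      c ^ 4 * (ofLp (gradient q x) ⬝ᵥ (hessianMatrix q x).adjugate *ᵥ ofLp (gradient q x)) by ring,
    mul_div_mul_left _ _ hc4]

/-- **Sanity check on round spheres**: for `q = ‖·‖²`, whose level set through `x ≠ 0` is the
sphere of radius `‖x‖`, Goldman's formula gives `K = 1/‖x‖²` (`∇q = 2x`, `∇²q = 2I`,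
`adj(2I) = 4I`: `16‖x‖² / (2‖x‖)⁴`). [folklore] -/
theorem levelSetGaussCurvature_norm_sq {x : ℝ³} (hx : x ≠ 0) :
    levelSetGaussCurvature (fun y : ℝ³ => ‖y‖ ^ 2) x = (‖x‖ ^ 2)⁻¹ := by
  rw [levelSetGaussCurvature, hessianMatrix_norm_sq, gradient_norm_sq, Matrix.adjugate_smul,
    Matrix.adjugate_one, Fintype.card_fin]
  have hxx : ofLp x ⬝ᵥ ofLp x = ‖x‖ ^ 2 := by
    rw [← real_inner_self_eq_norm_sq, EuclideanSpace.inner_eq_star_dotProduct]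
    simp
  have hn : ‖x‖ ≠ 0 := norm_ne_zero_iff.2 hx
  simp only [WithLp.ofLp_smul, Matrix.smul_mulVec, Matrix.one_mulVec, Matrix.mulVec_smul,
    dotProduct_smul, smul_dotProduct, hxx, norm_smul, smul_eq_mul, Real.norm_ofNat]
  field_simp

/-! ### The Euler characteristic of a level set -/

/-- **The Euler characteristic `χ(Σ_s)` of the level set `Σ_s = q⁻¹{s}`** (with the subspace
topology of `ℝ³`): the homological Euler characteristic `Σₖ (−1)ᵏ rank Hₖ(Σ_s; ℤ)` of the tree
(`Literature.AlgebraicTopology.SingularHomology.relEuler ℤ ℤ Σ_s ∅`, Hatcher 2002, Thm. 2.44), the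
sum over the (finitely many, for a compact regular level) components of `2 − 2gᵢ`; `0` for an
empty level. [cite: HatcherAT2002, §2.2 Thm. 2.44 (Euler characteristic)] -/
abbrev levelSetEulerChar (q : ℝ³ → ℝ) (s : ℝ) : ℤ :=
  Literature.AlgebraicTopology.SingularHomology.relEuler ℤ ℤ ↥(q ⁻¹' {s}) (∅ : Set ↥(q ⁻¹' {s}))

/-- An empty level set has Euler characteristic `0`. [folklore] -/
theorem levelSetEulerChar_eq_zero_of_preimage_eq_empty {q : ℝ³ → ℝ} {s : ℝ} (h : q ⁻¹' {s} = ∅) :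
    levelSetEulerChar q s = 0 := by
  haveI : IsEmpty ↥(q ⁻¹' {s}) := by rw [h]; infer_instance
  have hfin := Literature.AlgebraicTopology.SingularHomology.FinRelHomology.of_isEmpty
    (R := ℤ) (M := ℤ) (X := ↥(q ⁻¹' {s})) (∅ : Set ↥(q ⁻¹' {s}))
  rw [levelSetEulerChar, hfin.relEuler_eq_sum]
  simp

/-! ### The named fact: level-set Gauss–Bonnet in coarea form -/

/-- **Level-set Gauss–Bonnet in coarea form (flat `ℝ³`).** Let `q : ℝ³ → ℝ` be smooth and let
`B ⊂ ℝ` be compact such that `q⁻¹(B)` is compact and contains no critical point of `q` (so every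
`s ∈ B` is a regular value and `Σ_s = q⁻¹{s}` is a compact regular surface — Abate–Tovena
Prop. 3.1.25 — orientable — Thm. 4.7.15 — with Gauss curvature `K = ∇qᵀadj(∇²q)∇q/|∇q|⁴` —
Goldman Thm. 4.1). Then
`∫_{q⁻¹(B)} K(x) |∇q(x)| dx = 2π ∫_B χ(Σ_s) ds`:
the coarea formula `∫_{q⁻¹(B)} K |∇q| dx = ∫_B (∫_{Σ_s} K dℋ²) ds` (Evans–Gariepy Thm. 3.11,
`Jq = |∇q|`) followed by the Gauss–Bonnet theorem `∫_{Σ_s} K dℋ² = 2πχ(Σ_s)` on each level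
(Abate–Tovena Cor. 6.3.10, summed over components) — verbatim the step "by the coarea formula
and the Gauss–Bonnet theorem, `∫_{u⁻¹(B)} (|du|/2) R_Σ = ∫_B 2πχ(Σ_θ) dθ`" of Stern 2022, §2 (proof
of Thm. 1.1; `B` a closed set of regular values, `R_Σ = 2K_Σ`), and of Bray–Kazaras–Khuri–Stern
2022, proof of Prop. 4.2, specialised to the flat metric. On `B` the map `s ↦ χ(Σ_s)` is locally
constant (regular interval theorem), so the right-hand side is a finite integral. Consumers:
route `NavierStokesRegularity/IsobarTomography` (identity (GB), isobar Euler budget).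
[cite: Stern2022, §2, proof of Thm. 1.1 (coarea + Gauss–Bonnet step)] -/
def levelSet_gaussBonnet_coarea : Prop :=
  ∀ (q : ℝ³ → ℝ) (B : Set ℝ), ContDiff ℝ ∞ q → IsCompact B → IsCompact (q ⁻¹' B) →
    (∀ x ∈ q ⁻¹' B, gradient q x ≠ 0) →
    ∫ x in q ⁻¹' B, levelSetGaussCurvature q x * ‖gradient q x‖ =
      2 * π * ∫ s in B, (levelSetEulerChar q s : ℝ)

/-! ### Consequences: the isobar Euler budget of a regular slab -/

/-- **The isobar Euler budget of a regular closed slab** (the normalisation of route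
`IsobarTomography`'s definition request `isobarEulerBudget`): from `levelSet_gaussBonnet_coarea`
with `B = [a, b]`, for `q` smooth with `q⁻¹[a, b]` compact and free of critical points,
`2 ∫_{q⁻¹[a,b]} ∇qᵀadj(∇²q)∇q / |∇q|³ dx = 4π ∫_{[a,b]} χ(Σ_s) ds`.
[cite: Stern2022, §2, proof of Thm. 1.1 (coarea + Gauss–Bonnet step)] -/
theorem levelSet_gaussBonnet_coarea.slab (h : levelSet_gaussBonnet_coarea) {q : ℝ³ → ℝ}
    (hq : ContDiff ℝ ∞ q) {a b : ℝ} (hK : IsCompact (q ⁻¹' Icc a b))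
    (hreg : ∀ x ∈ q ⁻¹' Icc a b, gradient q x ≠ 0) :
    2 * ∫ x in q ⁻¹' Icc a b,
        (ofLp (gradient q x) ⬝ᵥ ((hessianMatrix q x).adjugate *ᵥ ofLp (gradient q x))) /
          ‖gradient q x‖ ^ 3 =
      4 * π * ∫ s in Icc a b, (levelSetEulerChar q s : ℝ) := by
  have h1 := h q (Icc a b) hq isCompact_Icc hK hreg
  simp_rw [levelSetGaussCurvature_mul_norm] at h1
  rw [h1]
  ring

/-- **The isobar Euler budget of a regular open slab**: the same with the open slab
`{a < q < b}` (the level sets `q⁻¹{a}`, `q⁻¹{b}` are Lebesgue-null,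
`preimage_Ioo_ae_eq_preimage_Icc`):
`2 ∫_{a<q<b} ∇qᵀadj(∇²q)∇q / |∇q|³ dx = 4π ∫_{[a,b]} χ(Σ_s) ds`.
[cite: Stern2022, §2, proof of Thm. 1.1 (coarea + Gauss–Bonnet step)] -/
theorem levelSet_gaussBonnet_coarea.slab_Ioo (h : levelSet_gaussBonnet_coarea) {q : ℝ³ → ℝ}
    (hq : ContDiff ℝ ∞ q) {a b : ℝ} (hK : IsCompact (q ⁻¹' Icc a b))
    (hreg : ∀ x ∈ q ⁻¹' Icc a b, gradient q x ≠ 0) :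
    2 * ∫ x in q ⁻¹' Ioo a b,
        (ofLp (gradient q x) ⬝ᵥ ((hessianMatrix q x).adjugate *ᵥ ofLp (gradient q x))) /
          ‖gradient q x‖ ^ 3 =
      4 * π * ∫ s in Icc a b, (levelSetEulerChar q s : ℝ) := by
  rw [setIntegral_congr_set (preimage_Ioo_ae_eq_preimage_Icc (hq.of_le (by simp)) hreg)]
  exact levelSet_gaussBonnet_coarea.slab h hq hK hreg

end GaussCurvature

end Literature.Geometry.Riemannian
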